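import Literature.AnabelianGeometry.SemiGraphs.PSCTwoComponentAffineShapeEdges
import Literature.AnabelianGeometry.SemiGraphs.ProSigmaHeisenbergSeparation
import Literature.AnabelianGeometry.SemiGraphs.PSCSmoothCurveShape
import HarnessLib

/-!
# [CombGC] Prop. 1.2 (i), edge-like case, at two-component data pointed on both sides (one marked point allowed)

Mochizuki, *A combinatorial version of the Grothendieck conjecture* [CombGC] §1, Prop. 1.2 (i) p. 8
[cite: MochizukiCombGC2007, Prop 1.2(i) p.8].  PROOF-ONLY sequel (abc-iut-f-164 gen 2; row F-0459) to
`PSCTwoComponentAffineShape(Edges).lean` (data of TWO-COMPONENT AFFINE SHAPE: two pointed components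
`C₀ ∪_ν C₁` glued at one node; `Π` a pro-`Σ` completion `ι : Γ_{g,r} → Π`; cusps `s ≤ j` on `C₀`, `j < s`
on `C₁`; `Π_ν = closure ι⟨ε⟩`, `ε = (c_s ⋯ c_{r−1}) · ∏_{i<g₀}[a_i,b_i]`), where each component had at least
TWO marked points.  Here: **at least ONE marked point on each component, both components stable**
(`2g₀ + (r − s) ≥ 2`, `2(g − g₀) + s ≥ 2`).  With a single marked point `c_j` on a component the node loop
`ε` is homologous to `c_j^{±1}` and no abelian character separates `Π_ν` from `Π_{c_j}`; the separation
uses the NON-ABELIAN quotients `Γ_{g,r} → (ℤ/ℓⁿ × ℤ/ℓⁿ) ⋊ ℤ/ℓⁿ` of `ProSigmaHeisenbergSeparation.lean`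
with one active handle `(a, b) ↦ (X, Y)` on the component of `c_j` (positive genus by stability) and one
active cusp `↦ Z⁻¹ = [X,Y]⁻¹` (`c_j` itself: `ε ↦ 1`, `c_j ↦ Z⁻¹`; or a cusp of the other component:
`c_j ↦ 1`, `ε ↦ Z^{±1}`) — an open intersection would force `Z^m = 1` with `m < ℓ^m`.  Cusp versus cusp
is the tree's malnormality of cusp inertia (abc-iut-L3-t4's `smul_cuspGp_inf_smul_cuspGp_eq_bot`); the
result is `edgeLikeOpenInterDeterminesEdge_of_twoComponentAffine'` (the verticial case — a handle
character of a component with one marked point — and the assembly with the unramified case and with rows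
F-1931 / F-0458 are in `PSCTwoComponentAffinePointedOrigin.lean`).  Shape instances are
consistency evidence for the typed schema, not the printed theorem for all pointed stable curves; nothing
here takes a side on [IUTchIII] Cor. 3.12.
-/

noncomputable section

namespace Literature.AnabelianGeometry.SemiGraphs

open scoped Pointwise
open Literature.GroupTheory.CombinatorialGroupTheory
open SemiGraphOfAnabelioids (IsProSigmaCompletion)
open Multiplicative

universe u

namespace PSCDatum

open TwoComponentAffine

variable {P : Type u} [Group P] [TopologicalSpace P] [IsTopologicalGroup P]
variable [CompactSpace P] [T2Space P] [TotallyDisconnectedSpace P] {Sigma : Set ℕ} {g r : ℕ}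

omit [CompactSpace P] [T2Space P] [TotallyDisconnectedSpace P] in
/-- A conjugate of a closed subgroup is closed (private copy of abc-iut-w5-d183's `isClosed_conj_smul`).
[cite: MochizukiCombGC2007, Def 1.1(ii) p.6] -/
private theorem isClosed_conj_smul₂ {A : Subgroup P} (hA : IsClosed (A : Set P)) (γ : ConjAct P) :
    IsClosed ((γ • A : Subgroup P) : Set P) := by
  have h : ((γ • A : Subgroup P) : Set P) = (fun x : P => γ⁻¹ • x) ⁻¹' (A : Set P) := by
    ext x
    rw [SetLike.mem_coe, Subgroup.mem_pointwise_smul_iff_inv_smul_mem]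
    rfl
  rw [h]
  refine hA.preimage ?_
  simp only [ConjAct.smul_def]
  fun_prop

omit [CompactSpace P] [T2Space P] [TotallyDisconnectedSpace P] in
/-- A homomorphism with closed kernel killing `z ∈ Γ` kills `cl ι⟨z⟩`.
[cite: MochizukiCombGC2007, Prop 1.2(i) p.8] -/
private theorem map_zpowers_closure_le_ker_of_isClosed {Γ : Type*} [Group Γ] (ι : Γ →* P)
    {Q : Type*} [Group Q] (Ψ : P →* Q) (hk : IsClosed (Ψ.ker : Set P)) (z : Γ) (hz : Ψ (ι z) = 1) :
    ((Subgroup.zpowers z).map ι).topologicalClosure ≤ Ψ.ker :=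
  Subgroup.topologicalClosure_minimal _
    (Subgroup.map_le_iff_le_comap.mpr ((Subgroup.zpowers_le).mpr (by simpa using hz))) hk

/-! ### Edge-like case: Heisenberg quotients for the lone marked point -/

omit [T2Space P] in
/-- **The Heisenberg engine.**  `γ₁ι(γ₀)γ₁⁻¹ ∈ S`; if for every `n` some homomorphism
`ψ : Γ_{g,r} → H = (ℤ/ℓⁿ × ℤ/ℓⁿ) ⋊ ℤ/ℓⁿ` sends `γ₀` to `Z^{±1}` (`Z` the central generator of order `ℓⁿ`)
and all its continuous extensions to `Π` kill `T`, then `S ∩ T` is not open in `S` (a positive power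
`m` of `γ₁ι(γ₀)γ₁⁻¹` would lie in `T`, forcing `Z^m = 1` with `m < ℓ^m`).
[cite: MochizukiCombGC2007, Prop 1.2(i) p.8] -/
private theorem not_isOpen_of_heisenberg {ι : PuncturedSurfaceGroup g r →* P}
    (hι : IsProSigmaCompletion Sigma ι) {ℓ : ℕ} (hℓ : ℓ.Prime) (hℓS : ℓ ∈ Sigma) {S T : Subgroup P}
    (γ₁ : ConjAct P) (γ₀ : PuncturedSurfaceGroup g r) (hx : γ₁ • ι γ₀ ∈ S)
    (h : ∀ (n : ℕ) (φ : Multiplicative (ZMod (ℓ ^ n)) →* MulAut (Multiplicative (ZMod (ℓ ^ n) × ZMod (ℓ ^ n))))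
      (X Y Z : Multiplicative (ZMod (ℓ ^ n) × ZMod (ℓ ^ n)) ⋊[φ] Multiplicative (ZMod (ℓ ^ n))), X * Y * X⁻¹ * Y⁻¹ = Z →
      ∃ ψ : PuncturedSurfaceGroup g r →* Multiplicative (ZMod (ℓ ^ n) × ZMod (ℓ ^ n)) ⋊[φ] Multiplicative (ZMod (ℓ ^ n)), (ψ γ₀ = Z ∨ ψ γ₀ = Z⁻¹) ∧
        ∀ Ψ : P →* Multiplicative (ZMod (ℓ ^ n) × ZMod (ℓ ^ n)) ⋊[φ] Multiplicative (ZMod (ℓ ^ n)), IsClosed (Ψ.ker : Set P) → (∀ γ, Ψ (ι γ) = ψ γ) → T ≤ Ψ.ker) :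
    ¬ IsOpen (((S ⊓ T).subgroupOf S : Subgroup S) : Set S) := by
  intro hopen
  obtain ⟨n, hn, hxn⟩ := exists_pow_mem_of_isOpen_inf_subgroupOf hx hopen
  obtain ⟨φ, X, Y, Z, hXY, hZ, hcard⟩ := Heisenberg.exists_heisenbergTriple (ℓ ^ n)
  obtain ⟨ψ, hψ, hT⟩ := h n φ X Y Z hXY
  letI : TopologicalSpace (Multiplicative (ZMod (ℓ ^ n) × ZMod (ℓ ^ n)) ⋊[φ] Multiplicative (ZMod (ℓ ^ n))) := ⊥
  haveI : DiscreteTopology (Multiplicative (ZMod (ℓ ^ n) × ZMod (ℓ ^ n)) ⋊[φ] Multiplicative (ZMod (ℓ ^ n))) := ⟨rfl⟩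
  haveI : Finite (Multiplicative (ZMod (ℓ ^ n) × ZMod (ℓ ^ n)) ⋊[φ] Multiplicative (ZMod (ℓ ^ n))) :=
    Nat.finite_of_card_ne_zero (by rw [hcard]; exact pow_ne_zero _ (pow_ne_zero _ hℓ.ne_zero))
  obtain ⟨Ψ, hΨc, hΨ⟩ := hι.exists_continuous_extend_of_card_primePow hℓ hℓS (k := n * 3)
    (by rw [hcard, pow_mul]) ψ
  have hk : IsClosed (Ψ.ker : Set P) := by
    rw [MonoidHom.coe_ker]
    exact (isClosed_discrete _).preimage hΨc
  have h1 : Ψ ((γ₁ • ι γ₀) ^ n) = 1 := hT Ψ hk hΨ hxn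
  rw [map_pow, ConjAct.smul_def, map_mul, map_mul, map_inv, conj_pow, conj_eq_one_iff, hΨ] at h1
  have hdvd : ℓ ^ n ∣ n := by
    rcases hψ with hψ | hψ
    · exact (hZ n).mp (hψ ▸ h1)
    · rw [hψ, inv_pow, inv_eq_one] at h1
      exact (hZ n).mp h1
  exact absurd (Nat.le_of_dvd hn hdvd) (not_le.mpr (Nat.lt_pow_self hℓ.one_lt))

/-- **[CombGC] Prop. 1.2 (i), edge-like case, at two-component affine shape pointed on both sides**
(each component stable with at least one marked point).  Pairs: node/node — one node; cusp/cusp —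
malnormality of cusp inertia (abc-iut-L3-t4's `smul_cuspGp_inf_smul_cuspGp_eq_bot`); node/cusp and
cusp/node — the two-cusp characters of `edgeLikeOpenInterDeterminesEdge_of_twoComponentAffine` when the
relevant component has two marked points, otherwise the Heisenberg quotients with the active handle on
that component (see the module docstring). [cite: MochizukiCombGC2007, Prop 1.2(i) p.8] -/
theorem edgeLikeOpenInterDeterminesEdge_of_twoComponentAffine' (hne : Sigma.Nonempty)
    (hprime : ∀ p ∈ Sigma, p.Prime) (ι : PuncturedSurfaceGroup g r →* P)
    (hι : IsProSigmaCompletion Sigma ι) (G : PSCDatum P) {g₀ s : ℕ} (hg₀ : g₀ ≤ g) (hs : 1 ≤ s)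
    (hsr : s + 1 ≤ r) (hst₀ : 1 ≤ g₀ ∨ 2 ≤ r - s) (hst₁ : 1 ≤ g - g₀ ∨ 2 ≤ s)
    (e : G.graph.C ≃ Fin r)
    (hC : ∀ c, G.cuspGp c =
      ((PuncturedSurfaceGroup.cuspInertia (g := g) (e c)).map ι).topologicalClosure)
    (ε : PuncturedSurfaceGroup g r)
    (hε : ε = ((List.finRange r).map fun j : Fin r =>
          if s ≤ (j : ℕ) then PuncturedSurfaceGroup.c (g := g) j else 1).prod *
        ((List.finRange g).map fun i : Fin g => if (i : ℕ) < g₀ then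
          PuncturedSurfaceGroup.a (r := r) i * PuncturedSurfaceGroup.b i *
            (PuncturedSurfaceGroup.a i)⁻¹ * (PuncturedSurfaceGroup.b i)⁻¹ else 1).prod)
    (n₀ : G.graph.N) (hN : ∀ n, n = n₀)
    (hE : G.nodeGp n₀ = ((Subgroup.zpowers ε).map ι).topologicalClosure) :
    G.EdgeLikeOpenInterDeterminesEdge := by
  classical
  have hne' := hne
  obtain ⟨ℓ, hℓS⟩ := hne
  have hℓ : ℓ.Prime := hprime ℓ hℓS
  have hhyp : PuncturedSurfaceGroup.IsHyperbolicType g r := by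
    unfold PuncturedSurfaceGroup.IsHyperbolicType; omega
  intro e₁ e₂ γ₁ γ₂ hopen
  by_contra hne12
  rcases e₁ with n₁ | c₁ <;> rcases e₂ with n₂ | c₂
  · exact hne12 (by rw [hN n₁, hN n₂])
  · -- node vs cusp `j = e c₂`
    by_cases hab : (∃ k : Fin r, s ≤ (k : ℕ) ∧ k ≠ e c₂) ∧ ∃ m' : Fin r, ¬ s ≤ (m' : ℕ) ∧ m' ≠ e c₂
    · -- abelian: the character `δ_k − δ_m'`
      obtain ⟨⟨k, hk, hkj⟩, m', hm', hmj⟩ := hab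
      have hopen' := hopen
      change IsOpen ((((γ₁ • G.nodeGp n₁) ⊓ γ₂ • G.cuspGp c₂).subgroupOf (γ₁ • G.nodeGp n₁) :
        Subgroup (γ₁ • G.nodeGp n₁ : Subgroup P)) : Set (γ₁ • G.nodeGp n₁ : Subgroup P)) at hopen'
      rw [hN n₁, hE, hC, PuncturedSurfaceGroup.cuspInertia] at hopen'
      refine not_isOpen_inf_subgroupOf_of_characters hℓ.one_lt _ _ (x := γ₁ • ι ε)
        (Subgroup.smul_mem_pointwise_smul _ _ _ (Subgroup.le_topologicalClosure _
          (Subgroup.mem_map_of_mem ι (Subgroup.mem_zpowers ε)))) (fun n => ?_) hopen'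
      let wc : Fin r → ZMod (ℓ ^ n) := fun l => (if l = k then 1 else 0) + (if l = m' then -1 else 0)
      obtain ⟨φ, -, -, hφc⟩ :=
        PuncturedSurfaceGroup.exists_handleCuspCharacter (g := g) 0 0 wc (sum_twoDelta k m')
      obtain ⟨χ, hχc, hχ⟩ := exists_continuous_extend_zmod_pow hι hℓ hℓS n φ
      refine ⟨χ, smul_le_ker_of_le_ker (topologicalClosure_map_zpowers_le_ker ι χ hχc _ ?_) γ₂, ?_⟩
      · rw [hχ, hφc]; simp [wc, hkj.symm, hmj.symm]
      · rw [map_conjAct_smul_eq_self, hχ, hε, character_nodeLoop φ hφc, sum_ite_twoDelta, if_pos hk,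
          if_neg hm', add_zero]
    · -- Heisenberg: `j` is the lone marked point of its component
      refine not_isOpen_of_heisenberg hι hℓ hℓS (S := γ₁ • G.edgeGp (Sum.inl n₁))
        (T := γ₂ • G.edgeGp (Sum.inr c₂)) γ₁ ε ?_ (fun n φ X Y Z hXY => ?_) hopen
      · change γ₁ • ι ε ∈ γ₁ • G.nodeGp n₁
        rw [hN n₁, hE]
        exact Subgroup.smul_mem_pointwise_smul _ _ _ (Subgroup.le_topologicalClosure _
          (Subgroup.mem_map_of_mem ι (Subgroup.mem_zpowers ε)))
      · have hrel : X * Y * X⁻¹ * Y⁻¹ * Z⁻¹ = 1 := by rw [hXY, mul_inv_cancel]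
        by_cases hj : s ≤ ((e c₂ : Fin r) : ℕ)
        · -- `j` on `C₀` is its only marked point: `g₀ ≥ 1`; handle `0`, compensating cusp `0 ∈ C₁`
          have hr1 : ¬ 2 ≤ r - s := fun hr => hab ⟨?_, ⟨0, by omega⟩, by simp; omega,
            fun h => by rw [← h] at hj; simp at hj; omega⟩
          swap
          · by_cases h : ((e c₂ : Fin r) : ℕ) = s
            · exact ⟨⟨s + 1, by omega⟩, by simp, fun h' => absurd (congrArg Fin.val h') (by simp; omega)⟩
            · exact ⟨⟨s, by omega⟩, by simp, fun h' => absurd (congrArg Fin.val h') (by simp; omega)⟩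
          have hg : 1 ≤ g₀ := hst₀.resolve_right hr1
          obtain ⟨ψ, ha, hb, hc, hab', hc'⟩ := PuncturedSurfaceGroup.exists_hom_handle_cusp
            (g := g) (r := r) ⟨0, by omega⟩ ⟨0, by omega⟩ X Y Z⁻¹ hrel
          refine ⟨ψ, Or.inl ?_, fun Ψ hΨc hΨ => ?_⟩
          · rw [hε, PuncturedSurfaceGroup.hom_handle_cusp_nodeLoop ψ ha hb hc hab' hc' g₀ s,
              if_neg (by simp; omega), if_pos (by change 0 < g₀; omega), one_mul, hXY]
          · change γ₂ • G.cuspGp c₂ ≤ Ψ.ker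
            rw [hC, PuncturedSurfaceGroup.cuspInertia]
            refine smul_le_ker_of_le_ker (map_zpowers_closure_le_ker_of_isClosed ι Ψ hΨc _ ?_) γ₂
            rw [hΨ, hc' _ (fun h => by rw [h] at hj; simp at hj; omega)]
        · -- `j` on `C₁` is its only marked point: `s = 1`, `g - g₀ ≥ 1`; handle `g₀`, cusp `s ∈ C₀`
          have hs1 : ¬ 2 ≤ s := fun hs2 => hab ⟨⟨⟨s, by omega⟩, by simp, fun h => by
            rw [← h] at hj; simp at hj⟩, ?_⟩
          swap
          · by_cases h : ((e c₂ : Fin r) : ℕ) = 0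
            · exact ⟨⟨1, by omega⟩, by simp; omega, fun h' => absurd (congrArg Fin.val h') (by simp; omega)⟩
            · exact ⟨⟨0, by omega⟩, by simp; omega, fun h' => absurd (congrArg Fin.val h') (by simp; omega)⟩
          have hg : 1 ≤ g - g₀ := hst₁.resolve_right hs1
          obtain ⟨ψ, ha, hb, hc, hab', hc'⟩ := PuncturedSurfaceGroup.exists_hom_handle_cusp
            (g := g) (r := r) ⟨g₀, by omega⟩ ⟨s, by omega⟩ X Y Z⁻¹ hrel
          refine ⟨ψ, Or.inr ?_, fun Ψ hΨc hΨ => ?_⟩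
          · rw [hε, PuncturedSurfaceGroup.hom_handle_cusp_nodeLoop ψ ha hb hc hab' hc' g₀ s,
              if_pos (by simp), if_neg (by simp), mul_one]
          · change γ₂ • G.cuspGp c₂ ≤ Ψ.ker
            rw [hC, PuncturedSurfaceGroup.cuspInertia]
            refine smul_le_ker_of_le_ker (map_zpowers_closure_le_ker_of_isClosed ι Ψ hΨc _ ?_) γ₂
            rw [hΨ, hc' _ (fun h => by rw [h] at hj; simp at hj)]
  · -- cusp `j = e c₁` vs node
    by_cases hab : ∃ k : Fin r, k ≠ e c₁ ∧ (s ≤ (k : ℕ) ↔ s ≤ ((e c₁ : Fin r) : ℕ))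
    · -- abelian: `δ_j − δ_k` with `k` on the same component
      obtain ⟨k, hkj, hk⟩ := hab
      have hopen' := hopen
      change IsOpen ((((γ₁ • G.cuspGp c₁) ⊓ γ₂ • G.nodeGp n₂).subgroupOf (γ₁ • G.cuspGp c₁) :
        Subgroup (γ₁ • G.cuspGp c₁ : Subgroup P)) : Set (γ₁ • G.cuspGp c₁ : Subgroup P)) at hopen'
      rw [hN n₂, hE, hC, PuncturedSurfaceGroup.cuspInertia] at hopen'
      refine not_isOpen_inf_subgroupOf_of_characters hℓ.one_lt _ _
        (x := γ₁ • ι (PuncturedSurfaceGroup.c (e c₁)))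
        (Subgroup.smul_mem_pointwise_smul _ _ _ (Subgroup.le_topologicalClosure _
          (Subgroup.mem_map_of_mem ι (Subgroup.mem_zpowers _)))) (fun n => ?_) hopen'
      let wc : Fin r → ZMod (ℓ ^ n) := fun l =>
        (if l = e c₁ then 1 else 0) + (if l = k then -1 else 0)
      obtain ⟨φ, -, -, hφc⟩ :=
        PuncturedSurfaceGroup.exists_handleCuspCharacter (g := g) 0 0 wc (sum_twoDelta (e c₁) k)
      obtain ⟨χ, hχc, hχ⟩ := exists_continuous_extend_zmod_pow hι hℓ hℓS n φ
      refine ⟨χ, smul_le_ker_of_le_ker (topologicalClosure_map_zpowers_le_ker ι χ hχc _ ?_) γ₂,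
        by rw [map_conjAct_smul_eq_self, hχ, hφc]; simp [wc, hkj.symm]⟩
      rw [hχ, hε, character_nodeLoop φ hφc, sum_ite_twoDelta]
      by_cases hj : s ≤ ((e c₁ : Fin r) : ℕ)
      · rw [if_pos hj, if_pos (hk.mpr hj)]; simp
      · rw [if_neg hj, if_neg (fun h' => hj (hk.mp h'))]; simp
    · -- Heisenberg: `c_j ↦ Z⁻¹` with the active handle on the component of `j`, so that `ε ↦ 1`
      refine not_isOpen_of_heisenberg hι hℓ hℓS (S := γ₁ • G.edgeGp (Sum.inr c₁))
        (T := γ₂ • G.edgeGp (Sum.inl n₂)) γ₁ (PuncturedSurfaceGroup.c (e c₁)) ?_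
        (fun n φ X Y Z hXY => ?_) hopen
      · change γ₁ • ι (PuncturedSurfaceGroup.c (e c₁)) ∈ γ₁ • G.cuspGp c₁
        rw [hC]
        exact Subgroup.smul_mem_pointwise_smul _ _ _ (Subgroup.le_topologicalClosure _
          (Subgroup.mem_map_of_mem ι (Subgroup.mem_zpowers _)))
      · have hrel : X * Y * X⁻¹ * Y⁻¹ * Z⁻¹ = 1 := by rw [hXY, mul_inv_cancel]
        by_cases hj : s ≤ ((e c₁ : Fin r) : ℕ)
        · -- lone marked point of `C₀`: handle `0`
          have hr1 : ¬ 2 ≤ r - s := by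
            intro hr
            by_cases h : ((e c₁ : Fin r) : ℕ) = s
            · exact hab ⟨⟨s + 1, by omega⟩, fun h' => absurd (congrArg Fin.val h') (by simp; omega),
                by simp; omega⟩
            · exact hab ⟨⟨s, by omega⟩, fun h' => absurd (congrArg Fin.val h') (by simp; omega),
                by simp; omega⟩
          have hg : 1 ≤ g₀ := hst₀.resolve_right hr1
          obtain ⟨ψ, ha, hb, hc, hab', hc'⟩ := PuncturedSurfaceGroup.exists_hom_handle_cusp
            (g := g) (r := r) ⟨0, by omega⟩ (e c₁) X Y Z⁻¹ hrel
          refine ⟨ψ, Or.inr hc, fun Ψ hΨc hΨ => ?_⟩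
          change γ₂ • G.nodeGp n₂ ≤ Ψ.ker
          rw [hN n₂, hE]
          refine smul_le_ker_of_le_ker (map_zpowers_closure_le_ker_of_isClosed ι Ψ hΨc _ ?_) γ₂
          rw [hΨ, hε, PuncturedSurfaceGroup.hom_handle_cusp_nodeLoop ψ ha hb hc hab' hc' g₀ s,
            if_pos hj, if_pos (by change 0 < g₀; omega), ← hXY, inv_mul_cancel]
        · -- lone marked point of `C₁`: handle `g₀`
          have hs1 : ¬ 2 ≤ s := by
            intro hs2
            by_cases h : ((e c₁ : Fin r) : ℕ) = 0
            · exact hab ⟨⟨1, by omega⟩, fun h' => absurd (congrArg Fin.val h') (by simp; omega),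
                by simp; omega⟩
            · exact hab ⟨⟨0, by omega⟩, fun h' => absurd (congrArg Fin.val h') (by simp; omega),
                by simp; omega⟩
          have hg : 1 ≤ g - g₀ := hst₁.resolve_right hs1
          obtain ⟨ψ, ha, hb, hc, hab', hc'⟩ := PuncturedSurfaceGroup.exists_hom_handle_cusp
            (g := g) (r := r) ⟨g₀, by omega⟩ (e c₁) X Y Z⁻¹ hrel
          refine ⟨ψ, Or.inr hc, fun Ψ hΨc hΨ => ?_⟩
          change γ₂ • G.nodeGp n₂ ≤ Ψ.ker
          rw [hN n₂, hE]
          refine smul_le_ker_of_le_ker (map_zpowers_closure_le_ker_of_isClosed ι Ψ hΨc _ ?_) γ₂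
          rw [hΨ, hε, PuncturedSurfaceGroup.hom_handle_cusp_nodeLoop ψ ha hb hc hab' hc' g₀ s,
            if_neg hj, if_neg (by simp), mul_one]
  · -- cusp vs cusp: malnormality of cusp inertia
    by_cases hc : c₁ = c₂
    · exact hne12 (by rw [hc])
    have hopen' := hopen
    change IsOpen ((((γ₁ • G.cuspGp c₁) ⊓ (γ₂ • G.cuspGp c₂)).subgroupOf (γ₁ • G.cuspGp c₁) :
      Subgroup (γ₁ • G.cuspGp c₁ : Subgroup P)) : Set (γ₁ • G.cuspGp c₁ : Subgroup P)) at hopen'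
    rw [G.smul_cuspGp_inf_smul_cuspGp_eq_bot hne' hprime hhyp ι hι e hC hc, Subgroup.bot_subgroupOf,
      Subgroup.coe_bot] at hopen'
    haveI : DiscreteTopology (γ₁ • G.cuspGp c₁ : Subgroup P) :=
      discreteTopology_iff_isOpen_singleton_one.mpr hopen'
    haveI : CompactSpace (γ₁ • G.cuspGp c₁ : Subgroup P) :=
      isCompact_iff_compactSpace.mp (isClosed_conj_smul₂ (G.isClosed_cuspGp c₁) γ₁).isCompact
    haveI := G.infinite_cuspGp hne' hprime hhyp ι hι e hC c₁
    haveI : Infinite (γ₁ • G.cuspGp c₁ : Subgroup P) :=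
      Infinite.of_injective _ (Subgroup.equivSMul γ₁ (G.cuspGp c₁)).injective
    exact (‹Infinite (γ₁ • G.cuspGp c₁ : Subgroup P)›).not_finite finite_of_compact_of_discrete

end PSCDatum

end Literature.AnabelianGeometry.SemiGraphs

end
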